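import Summits.QuantumFields.YangMills.Theorems.UnitScaleTiltHalvingHSupURhoWindowsRho3Prelim
import HarnessLib

/-!
# Line H (`BirthV10.stub_halvingStep`, stmt-QuantumFields-19200), BOARD v6 STEP-LEAF JOINT — row «(E2) HARVEST-2CDA»:
# ROW 20 `40d·c_B + α₄ ≤ 1/(4B₀'_H·2C′₂)` AND THE TWO NONLINEAR WINDOWS (1.103) `B_G·M ≤ α₄/4`, (1.106) `B_G·K ≤ ½` OF THE JOIN AT `c_DA := 2·d·L²·c⋆`, `τ := 0`,
# FROM THE ONE CUBIC SMALLNESS `hw` OF ✓`HalvingHSupURhoWindowsRho3.exists_topCall_constants_of_rhoWindow₃`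

Cell `ym3-torus` (HUMAN RULING D-0037: YM₃ on T³ is ladder rung R3 — NOT d = 4, NOT a mass gap, NOT the Clay problem); width seat `ym-ust-19936-w7` gen 9;
row named by LEAD-H ★w5-19200 g6 (H-NAMER WORD 11, 2026-08-28T22:56:25Z).  `--supports stmt-QuantumFields-19200 --as helper`; THEOREMS ONLY (0 `def`,
0 `sorry`); count-neutral; PURE REAL ARITHMETIC — nothing here claims the packs, `hSupUρ4`, the stub, the crux or the gap.

WHY.  The harvest ✓`exists_topCall_constants_of_rhoWindow₃` serves rows (1.103)/(1.106) (its group (5)) at its own letter `cDA = d·L²·c⋆`; the JOIN's 27-row `hwin`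
(lit ✓`B8SockHFPWindows.hfpWindows_of_guard`, conclusion VERBATIM; FILE C ★`hT4T_of_leafSocketsB9` of ★w3-19200 g9) fixes `cDA = 2·d·L²·c⋆` and the Sect. E sizes
`h_E = B₀'_H·C′₂(40d·c_B + α₄)α₄`, `h_E₂ = B₂'·C′₂(40d·c_B + α₄)α₄`, `l_E = B₀'_H·4C′₂(40d·c_B + 2α₄)`, `l_E₂ = B₂'·4C′₂(40d·c_B + 2α₄)` — rows 23–25 follow from
the harvest by monotonicity (`h_E ≤ B₀'_H·Cb` is its group (3) floor), rows 26–27 do NOT (the `cDA` letter is doubled), and row 20 asks `1/(4B₀'_H·2C′₂)` where the harvest's `Cb` floor∕ceiling give only `1/(2B₀'_H·C′₂)` (w2-19936 g9's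
LOCATE #1 + erratum, 22:48∕22:57Z).  This file supplies rows 20, 26, 27 (in this order, one conjunction `hW3`) at the doubled
letter, for the SAME schedule `m₀ α₀ α₁ c⋆ B₀' α₄ c_B` (hypotheses = the harvest's group (0) defining equations, so the member packs discharge them by `rfl`∕the
`obtain`ed equations), from the SAME `hw`: the doubled `cDA` is absorbed (i) in (1.103) by the structural share `B_G·B_R·c_DA ≤ α₄/40` (the OUTPUT `B₀' ≥ 300L·15L²·B_G·B_R`
leaves a factor `150L` of room) and (ii) in (1.106) by the inflated budget `V′ = 400L²·V₄ ≥ 2V₄` of the harvest's own proof (`c_DA ≤ 10170·V₄ ⇒ 2c_DA ≤ 10170·V′`).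
Proof = the harvest's letters block re-run (✓`…WindowsPrelim.sizes`∕`second_order`, ✓`…WindowsTop.drops`∕`top106`, ✓`…Rho3Prelim.budgets₃`∕`letters₃`∕`top103₃`)
at `(Cb, Cl, τ) := (C′₂(3)·(120c_B + α₄)α₄, 2C′₂(3)·(120c_B + 2α₄), 0)`.  Elementary real arithmetic; the mathematics is in the cited files.

References: T. Bałaban, CMP **99** (1985) 75–102 [Balaban1985RegularSpaces] ((1.102)–(1.103) p.93, (1.106) p.94, Sect. E (1.110)–(1.125) pp.95–97).
-/

set_option autoImplicit false

noncomputable section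

namespace Summit.QuantumFields.YangMills.Theorems.HalvingHSupURhoWindowMcKc2

open Literature.MathematicalPhysics.QuantumFieldTheory.Balaban1983to89
open B8Ineq125Concrete (C2p)
open B8Prop5ContractionKLevel (Mc Kc)
open HalvingHSupURhoWindowsPrelim HalvingHSupURhoWindowsTop HalvingHSupURhoWindowsRho3Prelim

/-- ★ **ROWS 20, 26–27 OF THE JOIN AT `c_DA = 2·d·L²·c⋆`, `τ = 0`, FROM THE CUBIC SMALLNESS `hw`.**  For `d = 3`, `L ≥ 2`, the [4]-letters constants with their signs,
`M′ ρ′ : ℕ`, `ε₀ > 0` under the harvest's `hw`, and the harvest's schedule `m₀ = 3(M′+ρ′)+1`, `α₀ = ε₀`, `α₁`, `c⋆ = 5dLB₀(α₀+α₁)`,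
`B₀' = 300·L·m₀·(B₀'_H + 15L²B_G·B_R + 3B_G·B_R·B₂')`, `α₄ = 8B₀'(5dLB₀)(α₀+α₁)`, `c_B = L·c⋆` (group (0) of ✓`exists_topCall_constants_of_rhoWindow₃`, same letters):
row 20 `40d·c_B + α₄ ≤ 1/(4B₀'_H·2C′₂)`, (1.103) `B_G·Mc d B_R (α₄/4 + h_E) c_B h_E₂ (2dL²c⋆) ≤ α₄/4` and (1.106) `B_G·Kc d B_R (α₄/4 + h_E) c_B h_E₂ (2dL²c⋆) l_E₂ (1+l_E) (1+l_E) ≤ ½` with the JOIN's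
Sect. E sizes `h_E, h_E₂, l_E, l_E₂` written out. [cite: Balaban1985RegularSpaces, (1.102)-(1.103) p.93, (1.106) p.94, Sect. E (1.120)-(1.125) pp.95-97] -/
theorem hwin_rows_20_26_27_of_hw (d L : ℕ) (hd : d = 3) (hL : 2 ≤ L)
    {B₀ B₀'H B₂' BG BR cB9 : ℝ} (hB₀ : 0 < B₀) (hB₀'H : 0 < B₀'H) (hB₂' : 0 ≤ B₂') (hBG : 0 ≤ BG) (hBR : 0 ≤ BR) (hcB9 : 0 < cB9)
    (M' ρ' : ℕ) {ε₀ : ℝ} (hε₀ : 0 < ε₀)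
    (hw : (10 : ℝ) ^ 29 * (L : ℝ) ^ 12 * (1 + B₀ + B₀⁻¹) ^ 2 * ((1 + B₀'H) * (1 + B₂') * (1 + BG) * (1 + BR)) ^ 5 * (1 + cB9⁻¹) *
      (((ρ' : ℝ) + M' + 1) ^ 3 * ε₀) ≤ 1)
    {m₀ : ℕ} {α₀ α₁ cstar B₀' α₄ : ℝ}
    (e0 : m₀ = 3 * (M' + ρ') + 1) (eα₀ : α₀ = ε₀)
    (e1 : α₁ = 198 * (((ρ' : ℝ) + M' + 1) * ε₀) + 27 * (((ρ' : ℝ) + M' + 1) * ε₀) / ((L : ℝ) * B₀))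
    (ec : cstar = 5 * d * L * B₀ * (α₀ + α₁))
    (eB : B₀' = 300 * (L : ℝ) * m₀ * (B₀'H + 15 * (L : ℝ) ^ 2 * BG * BR + 3 * BG * BR * B₂'))
    (e4 : α₄ = 8 * B₀' * (5 * (d : ℝ) * L * B₀) * (α₀ + α₁)) :
    40 * d * ((L : ℝ) * cstar) + α₄ ≤ 1 / (4 * B₀'H * (2 * C2p d)) ∧
    BG * Mc d BR (α₄ / 4 + B₀'H * (C2p d * (40 * d * ((L : ℝ) * cstar) + α₄) * α₄)) ((L : ℝ) * cstar)
        (B₂' * (C2p d * (40 * d * ((L : ℝ) * cstar) + α₄) * α₄)) (2 * (d : ℝ) * (L : ℝ) ^ 2 * cstar) ≤ α₄ / 4 ∧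
    BG * Kc d BR (α₄ / 4 + B₀'H * (C2p d * (40 * d * ((L : ℝ) * cstar) + α₄) * α₄)) ((L : ℝ) * cstar)
        (B₂' * (C2p d * (40 * d * ((L : ℝ) * cstar) + α₄) * α₄)) (2 * (d : ℝ) * (L : ℝ) ^ 2 * cstar)
        (B₂' * (4 * C2p d * (40 * d * ((L : ℝ) * cstar) + 2 * α₄))) (1 + B₀'H * (4 * C2p d * (40 * d * ((L : ℝ) * cstar) + 2 * α₄)))
        (1 + B₀'H * (4 * C2p d * (40 * d * ((L : ℝ) * cstar) + 2 * α₄))) ≤ 1 / 2 := by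
  subst hd
  subst α₀
  -- letters (the harvest's block, verbatim where possible)
  set ℓ : ℝ := (L : ℝ) with hℓdef
  have hℓ2 : (2 : ℝ) ≤ ℓ := by rw [hℓdef]; exact_mod_cast hL
  have hℓ1 : (1 : ℝ) ≤ ℓ := by linarith only [hℓ2]
  have hℓ0 : (0 : ℝ) ≤ ℓ := by linarith only [hℓ2]
  have hρ0 : (0 : ℝ) ≤ ρ' := Nat.cast_nonneg _
  have hM0 : (0 : ℝ) ≤ M' := Nat.cast_nonneg _
  obtain ⟨n, hn⟩ : ∃ n : ℝ, n = (ρ' : ℝ) + M' + 1 := ⟨_, rfl⟩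
  have hn1 : 1 ≤ n := by rw [hn]; linarith only [hρ0, hM0]
  obtain ⟨s, hs⟩ : ∃ s : ℝ, s = n * ε₀ := ⟨_, rfl⟩
  have hs0 : 0 < s := by rw [hs]; positivity
  have hεs : ε₀ ≤ s := by rw [hs]; have := mul_nonneg (sub_nonneg.mpr hn1) hε₀.le; linarith only [this]
  obtain ⟨X₀, hX₀⟩ : ∃ X₀ : ℝ, X₀ = 1 + B₀ + B₀⁻¹ := ⟨_, rfl⟩
  obtain ⟨Y, hY⟩ : ∃ Y : ℝ, Y = (1 + B₀'H) * (1 + B₂') * (1 + BG) * (1 + BR) := ⟨_, rfl⟩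
  have hBinv0 : 0 < B₀⁻¹ := inv_pos.mpr hB₀
  have hX₀1 : 1 ≤ X₀ := by rw [hX₀]; linarith only [hB₀.le, hBinv0.le]
  have hX₀0 : 0 ≤ X₀ := by linarith only [hX₀1]
  have hB₀X : B₀ ≤ X₀ := by rw [hX₀]; linarith only [hBinv0.le]
  have hBiX : B₀⁻¹ ≤ X₀ := by rw [hX₀]; linarith only [hB₀.le]
  obtain ⟨hY1, hB₀'HY, hB₂'Y, hBGY, hBRY, hBGBRY, hBGBRBY, hYlow⟩ := Y_letters hB₀'H.le hB₂' hBG hBR hY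
  have hY0 : 0 ≤ Y := by linarith only [hY1]
  obtain ⟨c, hc⟩ : ∃ c : ℝ, c = cB9⁻¹ := ⟨_, rfl⟩
  have hc0 : 0 ≤ c := by rw [hc]; exact (inv_pos.mpr hcB9).le
  have hW : (10 : ℝ) ^ 29 * ℓ ^ 12 * X₀ ^ 2 * Y ^ 5 * (1 + c) * (n ^ 2 * s) ≤ 1 := by
    have h : n ^ 2 * s = ((ρ' : ℝ) + M' + 1) ^ 3 * ε₀ := by rw [hs, hn]; ring
    rw [hX₀, hY, hc, h]; exact hw
  obtain ⟨hB1, hB3, hB4, hB5, hB6, -, hB9, hB10, -⟩ := budgets₃ hℓ1 hX₀1 hY1 hc0 hn1 hs0.le hW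
  -- the inflated letter `Y′ := 400ℓ³nY`
  obtain ⟨Y', hY'⟩ : ∃ y : ℝ, y = 400 * ℓ ^ 3 * n * Y := ⟨_, rfl⟩
  have hYY' : Y ≤ Y' := by
    rw [hY']
    have h1 : (1 : ℝ) ≤ 400 * ℓ ^ 3 * n := by
      have := one_le_mul_of_one_le_of_one_le (one_le_pow₀ hℓ1 : (1 : ℝ) ≤ ℓ ^ 3) hn1; nlinarith only [this]
    have := mul_le_mul_of_nonneg_right h1 hY0; linarith only [this]
  have hY'1 : 1 ≤ Y' := hY1.trans hYY'
  have hB₀'HY' : B₀'H ≤ Y' := hB₀'HY.trans hYY'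
  rw [← hY'] at hB3 hB4 hB5 hB6
  -- the base letters and their sizes
  have hα₁ : α₁ = 198 * s + 27 * s / (ℓ * B₀) := by rw [e1, hs, hn]
  have hcs : cstar = 15 * ℓ * B₀ * (ε₀ + α₁) := by rw [ec]; push_cast; ring
  obtain ⟨B₀'b, hB₀'b⟩ : ∃ b : ℝ, b = B₀'H + 15 * ℓ ^ 2 * BG * BR + 3 * BG * BR * B₂' := ⟨_, rfl⟩
  obtain ⟨α₄b, hα₄b⟩ : ∃ a : ℝ, a = 8 * B₀'b * cstar := ⟨_, rfl⟩
  obtain ⟨cB, hcB⟩ : ∃ x : ℝ, x = ℓ * cstar := ⟨_, rfl⟩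
  obtain ⟨cDA, hcDA⟩ : ∃ x : ℝ, x = 3 * ℓ ^ 2 * cstar := ⟨_, rfl⟩
  obtain ⟨Clb, hClb⟩ : ∃ x : ℝ, x = 2 * 579944448 * (120 * cB + 2 * α₄b) := ⟨_, rfl⟩
  obtain ⟨hα₁L, hα₁U, hcsL, hcsU, hcs0, hbL1, hbL2, hbL3, hbU, hb0, -, -, -, -, -, -, -, -, hV0, -⟩ :=
    sizes hℓ1 hB₀ hX₀1 hB₀X hBiX hY1 hB₀'H hB₂' hBG hBR hYlow hs0 hε₀ hεs hα₁ hcs hB₀'b hα₄b hcB hcDA hClb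
  have hcB0 : 0 ≤ cB := by rw [hcB]; positivity
  -- `m₀` and the ρ3 letters
  obtain ⟨m, hm⟩ : ∃ m : ℝ, m = ((3 * (M' + ρ') + 1 : ℕ) : ℝ) := ⟨_, rfl⟩
  have hmE : m = 3 * ((M' : ℝ) + ρ') + 1 := by rw [hm]; push_cast; ring
  have hm1 : 1 ≤ m := by rw [hmE]; linarith only [hρ0, hM0]
  have hm3 : m ≤ 3 * n := by rw [hmE, hn]; linarith only [hρ0]
  have hB₀' : B₀' = 300 * ℓ * m * B₀'b := by rw [eB, hB₀'b, hm, e0]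
  have hα₄ : α₄ = 8 * B₀' * cstar := by rw [e4, hcs]; push_cast; ring
  obtain ⟨a₆₆, ha₆₆⟩ : ∃ a : ℝ, a = 198 * ε₀ + 12 * ((M' : ℝ) - 1 + 4 * ρ') * ε₀ := ⟨_, rfl⟩
  have ha66L : 0 ≤ a₆₆ := by
    rw [ha₆₆]; nlinarith only [hε₀, hρ0, hM0]
  have ha66U : a₆₆ ≤ 198 * s := by
    rw [ha₆₆, hs, hn]
    have e1 := mul_nonneg hM0 hε₀.le
    have e2 := mul_nonneg hρ0 hε₀.le
    linarith only [e1, e2, hε₀]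
  obtain ⟨σ, hσ⟩ : ∃ x : ℝ, x = 2 * ℓ * (cstar + a₆₆) := ⟨_, rfl⟩
  obtain ⟨δ, hδ⟩ : ∃ x : ℝ, x = 40 * ℓ * σ := ⟨_, rfl⟩
  obtain ⟨ω, hω⟩ : ∃ x : ℝ, x = 3 * ℓ * α₄ / 2 := ⟨_, rfl⟩
  obtain ⟨τ₀, hτ₀⟩ : ∃ t : ℝ, t = 16 * m * σ := ⟨_, rfl⟩
  obtain ⟨Cl, hCl⟩ : ∃ x : ℝ, x = 2 * 579944448 * (120 * cB + 2 * α₄) + 10240 * (3 * ℓ) * (α₄ + δ + 11 * ω) := ⟨_, rfl⟩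
  obtain ⟨Cb₂, hCb₂⟩ : ∃ x : ℝ, x = 640 * (α₄ + δ + 5 * ω) * ω := ⟨_, rfl⟩
  obtain ⟨-, -, hα₄0, hα₄U, -, -, -, hδ0, -, hω0, -, -, -, -, htU, hQU, -, hClU, -, -, -, -, -, -, -, hsV₄, hcBV₄, hcDAV₄⟩ :=
    letters₃ hℓ1 hX₀1 hY1 hBG hBR hB₂' hB₀'H hn1 hs0 hεs hm1 hm3 ha66L ha66U hcs0 hcsL hcsU hb0 hbU hbL1 hbL2 hbL3 hB₀' hα₄ hσ hδ hω hτ₀ hcB hcDA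
      hCl hCb₂
  set V₄ : ℝ := ℓ ^ 4 * X₀ * Y * n * s with hV₄
  have hV₄0 : 0 ≤ V₄ := by positivity
  obtain ⟨V', hV'⟩ : ∃ v : ℝ, v = ℓ ^ 3 * X₀ * Y' * s := ⟨_, rfl⟩
  have hV'E : V' = 400 * ℓ ^ 2 * V₄ := by rw [hV', hY', hV₄]; ring
  have hℓsq2 : 2 ≤ ℓ ^ 2 := by nlinarith only [hℓ2]
  have hV₄V' : 2 * 10 ^ 8 * V₄ ≤ 10 ^ 6 * V' := by
    rw [hV'E]; have := mul_le_mul_of_nonneg_right hℓsq2 hV₄0; linarith only [this, hV₄0]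
  have hV₄V'' : V₄ ≤ V' := by linarith only [hV₄V', hV₄0]
  have hsV' : s ≤ V' := hsV₄.trans hV₄V''
  -- the first-order `Cb₁`, `Cl₁` of the JOIN's Sect. E sizes (`C′₂(3) = 579944448`)
  obtain ⟨Cb₁, hCb₁⟩ : ∃ x : ℝ, x = 579944448 * (120 * cB + α₄) * α₄ := ⟨_, rfl⟩
  obtain ⟨C₂, hC₂⟩ : ∃ x : ℝ, x = 33554432 := ⟨_, rfl⟩
  obtain ⟨hCb₁0, hCb₁U, hCb₁ρ, -, -⟩ :=
    second_order (Cb := Cb₁) hℓ1 hX₀1 hY'1 hs0 hε₀ hεs hB₀'HY' hα₁L hcs0 hα₄0 hcB0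
      (by rw [← hV']; linarith only [hα₄U, hV₄V']) (by rw [← hV']; linarith only [htU, hV₄V']) (by rw [← hV']; linarith only [hQU, hV₄V'])
      (by rw [← hV']; exact hsV') hCb₁ hC₂ hB4 hB5
  obtain ⟨Q, hQ⟩ : ∃ q : ℝ, q = ε₀ + 120 * cB + 8 * α₄ := ⟨_, rfl⟩
  obtain ⟨hQ11, -, hQY', -⟩ :=
    drops hℓ1 hX₀1 hB₀X hY'1 hc hcB9 hs0 hε₀ hεs hB1 hB3 hB4 hcs0 hcsL hcsU hα₁U hcB0 hα₄0 hQ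
      (by rw [hQ, ← hV']; linarith only [hQU, hV₄V'])
  have hQ0 : 0 ≤ Q := by rw [hQ]; positivity
  have hQY : 10 ^ 11 * Y * Q ≤ 1 := by
    have := mul_le_mul_of_nonneg_right hYY' hQ0; linarith only [this, hQY']
  have hα₄Q : 8 * α₄ ≤ Q := by rw [hQ]; linarith only [hε₀, hcB0]
  have hα₄1 : α₄ ≤ 1 := by linarith only [hα₄Q, hQ11]
  have hQY'' : 10 ^ 11 * Y * (120 * cB + 8 * α₄) ≤ 1 := by
    have e := mul_le_mul_of_nonneg_left (by rw [hQ]; linarith only [hε₀] : 120 * cB + 8 * α₄ ≤ Q) hY0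
    linarith only [e, hQY]
  -- the `Cl` ceiling of the harvest, inherited by `Cl₁ ≤ Cl`
  obtain ⟨Cl₁, hCl₁⟩ : ∃ x : ℝ, x = 2 * 579944448 * (120 * cB + 2 * α₄) := ⟨_, rfl⟩
  have hCl₁0 : 0 ≤ Cl₁ := by rw [hCl₁]; positivity
  have hCl₁Cl : Cl₁ ≤ Cl := by
    rw [hCl₁, hCl]
    have : 0 ≤ 10240 * (3 * ℓ) * (α₄ + δ + 11 * ω) := by positivity
    linarith only [this]
  have hℓYV : ℓ ^ 2 * Y * V₄ ≤ 1 / 10 ^ 21 := by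
    rw [le_div_iff₀ (by norm_num : (0 : ℝ) < 10 ^ 21), hV₄]; linarith only [hB10]
  have hClB : Cl * B₀'H ≤ 1 / 2 := by
    have e := mul_le_mul hClU hB₀'HY hB₀'H.le (by positivity)
    linarith only [e, hℓYV]
  have hCl₁B : Cl₁ * B₀'H ≤ 1 / 2 := (mul_le_mul_of_nonneg_right hCl₁Cl hB₀'H.le).trans hClB
  have hCl₁U : Cl₁ ≤ 10 ^ 16 * V' := by
    rw [hV'E]; linarith only [hCl₁Cl, hClU, (by positivity : (0 : ℝ) ≤ ℓ ^ 2 * V₄)]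
  -- the (1.103) shares at the DOUBLED `cDA`
  have hBGBR : 0 ≤ BG * BR := mul_nonneg hBG hBR
  have h1 : BG * BR * (2 * cDA) ≤ α₄ / 40 := by
    rw [hcDA, hα₄, hB₀', le_div_iff₀ (by norm_num : (0 : ℝ) < 40)]
    have hℓm1 : 1 ≤ ℓ * m := one_le_mul_of_one_le_of_one_le hℓ1 hm1
    have e1 : 15 * ℓ ^ 2 * BG * BR * cstar ≤ B₀'b * cstar := mul_le_mul_of_nonneg_right hbL2 hcs0.le
    have e2 : B₀'b * cstar ≤ ℓ * m * (B₀'b * cstar) := by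
      have := mul_le_mul_of_nonneg_right hℓm1 (mul_nonneg hb0.le hcs0.le); linarith only [this]
    nlinarith only [e1, e2, hBGBR, hcs0.le, hℓ0, hb0.le]
  have hYQC : Y * (579944448 * (120 * cB + α₄)) ≤ 1 / 160 := by
    have e : 120 * cB + α₄ ≤ Q := by rw [hQ]; linarith only [hε₀, hα₄0]
    have := mul_le_mul_of_nonneg_left e hY0
    linarith only [this, hQY]
  have h3 : BG * BR * (B₂' * Cb₁) ≤ α₄ / 64 := by
    rw [le_div_iff₀ (by norm_num : (0 : ℝ) < 64), hCb₁]
    have e1 := mul_le_mul_of_nonneg_right hBGBRBY (by positivity : (0 : ℝ) ≤ 579944448 * (120 * cB + α₄))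
    have g1 := mul_le_mul_of_nonneg_right (e1.trans hYQC) hα₄0.le
    nlinarith only [g1, hα₄0]
  -- (1.103) at `(Cb, τ, cDA) := (Cb₁, 0, 2·cDA)`
  have h103 := top103₃ (τ := 0) (cDA := 2 * cDA) hBG hBR hB₀'H hY0 hBGBRY hα₄0 hcB0 hCb₁0 hCb₁ρ h1
    (by rw [mul_zero, mul_zero]; positivity) h3 hQY'' le_rfl (by rw [mul_zero]; positivity)
  -- (1.106) at `(Cb, Cl, τ, cDA) := (Cb₁, Cl₁, 0, 2·cDA)`
  have h106 := top106 (τ := 0) (cDA := 2 * cDA) hBR hB₂' hB₀'H hY1 hB₂'Y hBGY hBRY hs0 hsV' hα₄0 hα₄1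
    (by linarith only [hα₄U, hV₄V']) hcB0 (hcBV₄.trans (by linarith only [hV₄V''])) (by rw [hcDA]; positivity)
    (by linarith only [hcDAV₄, hV₄V', hV₄0]) hCb₁0 hCb₁U hCb₁ρ hCl₁0 hCl₁U hCl₁B (by rw [hV']; exact hB6) le_rfl
    (by linarith only [hs0]) (by rw [mul_zero]; positivity)
  -- re-lettering to the JOIN's Sect. E sizes (`C′₂(3) = 579944448`, ✓`HalvingHSupURhoWindowsPrelim.C2p_three`)
  have hC2p : C2p 3 = 579944448 := C2p_three
  rw [← hcB]
  refine ⟨?_, ?_, ?_⟩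
  · -- row 20: `40d·c_B + α₄ ≤ 1/(4B₀'_H·2C′₂)` (the harvest exports only the `1/(2B₀'_H·C′₂)` reading of its `Cb` floor∕ceiling)
    rw [hC2p, le_div_iff₀ (by positivity)]
    have e1 := (mul_le_mul_of_nonneg_right hB₀'HY (by positivity : (0 : ℝ) ≤ 579944448 * (120 * cB + α₄))).trans hYQC
    have e2 : (40 * ((3 : ℕ) : ℝ) * cB + α₄) * (4 * B₀'H * (2 * 579944448)) = 8 * (B₀'H * (579944448 * (120 * cB + α₄))) := by
      push_cast; ring
    rw [e2]; linarith only [e1]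
  · have eCb : C2p 3 * (40 * ((3 : ℕ) : ℝ) * cB + α₄) * α₄ = Cb₁ := by rw [hCb₁, hC2p]; push_cast; ring
    have ecDA : 2 * ((3 : ℕ) : ℝ) * ℓ ^ 2 * cstar = 2 * cDA := by rw [hcDA]; push_cast; ring
    rw [eCb, ecDA]
    simpa only [add_zero] using h103
  · have eCb : C2p 3 * (40 * ((3 : ℕ) : ℝ) * cB + α₄) * α₄ = Cb₁ := by rw [hCb₁, hC2p]; push_cast; ring
    have eCl : 4 * C2p 3 * (40 * ((3 : ℕ) : ℝ) * cB + 2 * α₄) = 2 * Cl₁ := by rw [hCl₁, hC2p]; push_cast; ring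
    have ecDA : 2 * ((3 : ℕ) : ℝ) * ℓ ^ 2 * cstar = 2 * cDA := by rw [hcDA]; push_cast; ring
    rw [eCb, eCl, ecDA]
    simpa only [add_zero] using h106

end Summit.QuantumFields.YangMills.Theorems.HalvingHSupURhoWindowMcKc2

end
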